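import Literature.Probability.RandomPlanarGeometry.HexSAWLemma2
import Literature.Probability.RandomPlanarGeometry.HexSAWBridges
import HarnessLib

/-!
# Duminil-Copin–Smirnov, Theorem 1: the connective constant of the honeycomb lattice is `√(2+√2)`

Topic `Literature/Probability/RandomPlanarGeometry`; this file DISCHARGES the named fact
`Literature.Probability.RandomPlanarGeometry.SAW.DuminilCopinSmirnov2012_thm1` (`HexSAW.lean`):
H. Duminil-Copin, S. Smirnov, *The connective constant of the honeycomb lattice equals `√(2+√2)`*,
Ann. of Math. 175 (2012), 1653–1665 (arXiv:1007.0575), **Theorem 1**: "For the hexagonal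
lattice, `μ = √(2+√2)`", i.e. `cₙ(ℍ)^{1/n} → √(2+√2)` with `cₙ` the number of `n`-step
self-avoiding walks from a fixed vertex.

The proof is assembled from the sorry-free development of the whole paper in this directory:
`HexSAWLattice` (coordinates, `c_{n+m} ≤ cₙ c_m`, Fekete), `HexSAWStrip` (strip domains,
`A_{T,L}`, `B_{T,L}`, `E_{T,L}`), `HexSAWWinding` (turning numbers of lattice polygons),
`HexSAWObservable` (parafermionic observable, Lemma 1, the summed relation), `HexSAWHopf`,
`HexSAWHopfPath`, `HexSAWBoundaryWinding` (discrete Hopf Umlaufsatz, boundary windings),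
`HexSAWLemma2` (Lemma 2: `DuminilCopinSmirnov2012_lemma2_holds`), `HexSAWLowerBound`
(`Z(x_c) = ∞`, `μ ≥ √(2+√2)`) and `HexSAWBridges` (Hammersley–Welsh, `μ ≤ √(2+√2)`,
`DuminilCopinSmirnov2012_thm1_of_lemma2`).
-/

noncomputable section

namespace Literature.Probability.RandomPlanarGeometry.SAW

/-- **Duminil-Copin–Smirnov 2012, Theorem 1** (discharge of the named fact
`DuminilCopinSmirnov2012_thm1` of `HexSAW.lean`): the connective constant of the hexagonal
lattice is `μ = √(2+√2)`, i.e. `cₙ(ℍ)^{1/n} → √(2+√2)`. Assembled from Lemma 2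
(`DuminilCopinSmirnov2012_lemma2_holds`, `HexSAWLemma2.lean`) and the two halves of §3
(`DuminilCopinSmirnov2012_thm1_of_lemma2`, `HexSAWBridges.lean`: `Z(x_c) = ∞` via the bridge
recursion, `Z(x) < ∞` for `x < x_c` via the Hammersley–Welsh decomposition).
[cite: DuminilCopinSmirnov2012, Thm 1] -/
theorem DuminilCopinSmirnov2012_thm1_holds : DuminilCopinSmirnov2012_thm1 :=
  DuminilCopinSmirnov2012_thm1_of_lemma2 DuminilCopinSmirnov2012_lemma2_holds

end Literature.Probability.RandomPlanarGeometry.SAW
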